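import Summits.ValiantsHypothesis.ValiantsHypothesis.Theorems.KPlusLogSqLawTropicalCycleMonotone

/-!
# Route «KPlusLogSqLaw», crux `TropicalB` (stmt-ValiantsHypothesis-19771) — the EXPIRATION PROPERTY of dominant chains:
# every sub-assignment with a fixed row image is optimal during ONE era (the matching analogue of Gusfield–Dean)

HONEST FRAMING.  Helper file (cell `pub-symmetroid`, seat val-sym-trop-p5 g19, refuter-adjacent lane, 2026-08-28;
`--supports stmt-ValiantsHypothesis-19771`).  A STRUCTURE law valid for every dominance design `(d, v, ε)` at every format `(m, K)`,
in the tree's vocabulary (`IsDominant` of `…MatrixDescartesFalseOfTropicalMonster`); it is a three-term COROLLARY of the cyclewise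
monotonicity law `sum_d_lt_of_isDominant_invariant` (conjb-2 g4 / val-sym-trop-p4 g2, module `…TropicalCycleMonotone`).  Nothing here
bounds the tropical census, and nothing bears on `TropicalB` in its window, `WeakLifting`, DoorA26 / DoorA34, `MatrixDescartes`
(stmt-ValiantsHypothesis-18050) or VP ≠ VNP.

THE LAW.  Let `(σᵢ, λᵢ)`, `(σⱼ, λⱼ)`, `(σₖ, λₖ)` be dominant (unique optima) at integer slopes `θᵢ < θⱼ < θₖ`, and let `T` be a column set
invariant under the quotient `σᵢ⁻¹σⱼ` (equivalently: `σⱼ` maps `T` onto the same row set as `σᵢ` — a union of cycles of the quotient plus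
common columns).  If the outer terms carry the SAME (row, class) data on `T`, then so does the middle term (`eqOn_of_between`).
Equivalently (`not_restored`, «NO RETURN ON DIFFERENCE CYCLES»): once a later dominant term re-matches the columns `T` onto the same rows
differently, the old sub-assignment on `T` is never dominant again.  So along a dominant chain, for every column set `T` and every row image
`R`, each sub-assignment `T → R` (with its classes) is used during ONE contiguous era of the sub-chain of terms mapping `T` onto `R`
(`chain_eqOn_of_between`).  This is, word for word, the EXPIRATION (alternation-free) property of parametric shortest-path sequences
[Gusfield 1980; Dean 2009; Gajjar–Radhakrishnan 2019, Prop. 2 «for vertices u, v on pᵢ, pⱼ, pₖ (i<j<k) with pᵢ[u:v] = pₖ[u:v] = q,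
also pⱼ[u:v] = q»] transported from sub-paths to sub-assignments; for paths it is the engine of the `n^{log n + O(1)}` upper bound
(midpoint recursion `f(n, 2^k − 1) ≤ 2n·f(n, 2^{k−1} − 1)`).  Proof: the partial exponent masses `∑_{b∈T} d(λ b)` satisfy
`sᵢ < sⱼ < sₖ = sᵢ` by two applications of the cyclewise law.

LOCATED CALIBRATION (this seat, session memo EXPIRATION-PROXY-g19.md, evidence on the item; NOT kernel facts): the purely pairwise
consequences of dominance (cyclewise monotonicity on every invariant block, hence this expiration property) over-count the census already at
`m = 2` (`4K − 7` admissible breakpoints against the true `3K − 4`) and `(3,4)` (`19` against `16`), and in the marked-edge sector they admit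
all `16` four-bit patterns on `6` nodes although `V(·,4) = 14` (the FOUR-BIT LAW, p642948, is invisible to pairwise exchange) — so any
census bound at the scale of `TropicalB` needs at least three-term (re-factorisation / Karamata) or metric (LP) input beyond this file.
[folklore] exchange argument; the path statement is Gusfield 1980 / Gajjar–Radhakrishnan 2019 (arXiv:1811.05115) Prop. 2.
-/

set_option linter.dupNamespace false
set_option autoImplicit false

namespace Summit.ValiantsHypothesis.ValiantsHypothesis.Theorems.KPlusLogSqLaw.Expiration

open Summit.ValiantsHypothesis.ValiantsHypothesis.Theorems.MatrixDescartes.Negative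
open Summit.ValiantsHypothesis.ValiantsHypothesis.Theorems.KPlusLogSqLaw
open scoped BigOperators

variable {m K : ℕ}

/-! ## §1 Invariant column sets -/

/-- the inverse of a permutation preserving `T` preserves `T`. [elementary] -/
theorem inv_mem_iff_of_mem_iff {π : Equiv.Perm (Fin m)} {T : Finset (Fin m)} (h : ∀ b, π b ∈ T ↔ b ∈ T) (b : Fin m) :
    π⁻¹ b ∈ T ↔ b ∈ T := by
  have := h (π⁻¹ b)
  rw [show π (π⁻¹ b) = b from π.apply_symm_apply b] at this
  exact this.symm

/-- a product of permutations preserving `T` preserves `T`. [elementary] -/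
theorem mul_mem_iff_of_mem_iff {π ρ : Equiv.Perm (Fin m)} {T : Finset (Fin m)} (hπ : ∀ b, π b ∈ T ↔ b ∈ T)
    (hρ : ∀ b, ρ b ∈ T ↔ b ∈ T) (b : Fin m) : (π * ρ) b ∈ T ↔ b ∈ T := by
  rw [Equiv.Perm.mul_apply, hπ, hρ]

/-- if two permutations agree on `T`, their quotient preserves `T` (it fixes `T` pointwise and permutes the complement). [elementary] -/
theorem quotient_mem_iff_of_eqOn {σ₁ σ₃ : Equiv.Perm (Fin m)} {T : Finset (Fin m)} (h : ∀ b ∈ T, σ₁ b = σ₃ b) (b : Fin m) :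
    (σ₁⁻¹ * σ₃) b ∈ T ↔ b ∈ T := by
  constructor
  · intro hb
    -- `c := σ₁⁻¹ (σ₃ b) ∈ T`, so `σ₃ b = σ₁ c = σ₃ c`, hence `b = c ∈ T`
    have hc : σ₃ b = σ₁ ((σ₁⁻¹ * σ₃) b) := by simp [Equiv.Perm.mul_apply]
    rw [h _ hb] at hc
    have : b = (σ₁⁻¹ * σ₃) b := σ₃.injective hc
    rw [this]; exact hb
  · intro hb
    have : (σ₁⁻¹ * σ₃) b = b := by
      rw [Equiv.Perm.mul_apply, ← h b hb]; simp
    rw [this]; exact hb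

/-- transport of invariance: if `T` is invariant under `σ₁⁻¹σ₂` and `σ₁, σ₃` agree on `T`, then `T` is invariant under `σ₂⁻¹σ₃`. [elementary] -/
theorem mem_iff_transport {σ₁ σ₂ σ₃ : Equiv.Perm (Fin m)} {T : Finset (Fin m)} (h₁₂ : ∀ b, (σ₁⁻¹ * σ₂) b ∈ T ↔ b ∈ T)
    (h₁₃ : ∀ b ∈ T, σ₁ b = σ₃ b) (b : Fin m) : (σ₂⁻¹ * σ₃) b ∈ T ↔ b ∈ T := by
  have e : σ₂⁻¹ * σ₃ = (σ₁⁻¹ * σ₂)⁻¹ * (σ₁⁻¹ * σ₃) := by group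
  rw [e]
  exact mul_mem_iff_of_mem_iff (inv_mem_iff_of_mem_iff h₁₂) (quotient_mem_iff_of_eqOn h₁₃) b

/-! ## §2 The expiration property (three dominant terms) -/

/-- **EXPIRATION PROPERTY (three-term form).**  Dominant terms at `θ₁ < θ₂ < θ₃`; `T` invariant under `σ₁⁻¹σ₂`; the outer terms agree
on `T` (rows and classes).  Then the middle term agrees with them on `T`. [folklore; matching analogue of Gajjar–Radhakrishnan 2019 Prop. 2] -/
theorem eqOn_of_between (d : Fin K → ℕ) (v ε : Fin m → Fin m → Fin K → ℤ) {θ₁ θ₂ θ₃ : ℤ} (h₁₂ : θ₁ < θ₂) (h₂₃ : θ₂ < θ₃)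
    {σ₁ σ₂ σ₃ : Equiv.Perm (Fin m)} {l₁ l₂ l₃ : Fin m → Fin K}
    (h₁ : IsDominant d v ε θ₁ (σ₁, l₁)) (h₂ : IsDominant d v ε θ₂ (σ₂, l₂)) (h₃ : IsDominant d v ε θ₃ (σ₃, l₃))
    (T : Finset (Fin m)) (hT : ∀ b, (σ₁⁻¹ * σ₂) b ∈ T ↔ b ∈ T) (h₁₃ : ∀ b ∈ T, σ₁ b = σ₃ b ∧ l₁ b = l₃ b) :
    ∀ b ∈ T, σ₂ b = σ₁ b ∧ l₂ b = l₁ b := by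
  by_contra hcon
  push Not at hcon
  obtain ⟨b₀, hb₀, hne₀⟩ := hcon
  -- the first two terms differ on `T`
  have hne₁₂ : ∃ b ∈ T, σ₁ b ≠ σ₂ b ∨ l₁ b ≠ l₂ b := by
    refine ⟨b₀, hb₀, ?_⟩
    by_cases hs : σ₂ b₀ = σ₁ b₀
    · exact Or.inr (fun h => hne₀ hs h.symm)
    · exact Or.inl (fun h => hs h.symm)
  -- so do the last two (the third agrees with the first on `T`)
  have hne₂₃ : ∃ b ∈ T, σ₂ b ≠ σ₃ b ∨ l₂ b ≠ l₃ b := by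
    refine ⟨b₀, hb₀, ?_⟩
    rw [← (h₁₃ b₀ hb₀).1, ← (h₁₃ b₀ hb₀).2]
    by_cases hs : σ₂ b₀ = σ₁ b₀
    · exact Or.inr (fun h => hne₀ hs h)
    · exact Or.inl hs
  have hT' : ∀ b, (σ₂⁻¹ * σ₃) b ∈ T ↔ b ∈ T := mem_iff_transport hT (fun b hb => (h₁₃ b hb).1)
  have lt₁ := sum_d_lt_of_isDominant_invariant d v ε h₁₂ h₁ h₂ T hT hne₁₂
  have lt₂ := sum_d_lt_of_isDominant_invariant d v ε h₂₃ h₂ h₃ T hT' hne₂₃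
  have eq : ∑ b ∈ T, (d (l₁ b) : ℤ) = ∑ b ∈ T, (d (l₃ b) : ℤ) :=
    Finset.sum_congr rfl (fun b hb => by rw [(h₁₃ b hb).2])
  omega

/-- **NO RETURN ON DIFFERENCE CYCLES.**  If a later dominant term `(σ₂, λ₂)` re-matches an invariant column block `T` of `σ₁⁻¹σ₂`
differently from `(σ₁, λ₁)`, then no still later dominant term restores `(σ₁, λ₁)` on `T`. [folklore] -/
theorem not_restored (d : Fin K → ℕ) (v ε : Fin m → Fin m → Fin K → ℤ) {θ₁ θ₂ θ₃ : ℤ} (h₁₂ : θ₁ < θ₂) (h₂₃ : θ₂ < θ₃)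
    {σ₁ σ₂ σ₃ : Equiv.Perm (Fin m)} {l₁ l₂ l₃ : Fin m → Fin K}
    (h₁ : IsDominant d v ε θ₁ (σ₁, l₁)) (h₂ : IsDominant d v ε θ₂ (σ₂, l₂)) (h₃ : IsDominant d v ε θ₃ (σ₃, l₃))
    (T : Finset (Fin m)) (hT : ∀ b, (σ₁⁻¹ * σ₂) b ∈ T ↔ b ∈ T) (hne : ∃ b ∈ T, σ₁ b ≠ σ₂ b ∨ l₁ b ≠ l₂ b) :
    ¬ ∀ b ∈ T, σ₁ b = σ₃ b ∧ l₁ b = l₃ b := by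
  intro h₁₃
  obtain ⟨b, hb, h⟩ := hne
  have e := eqOn_of_between d v ε h₁₂ h₂₃ h₁ h₂ h₃ T hT h₁₃ b hb
  rcases h with h | h
  · exact h e.1.symm
  · exact h e.2.symm

/-! ## §3 Chain form: eras of sub-assignments along a dominant chain -/

/-- **EXPIRATION PROPERTY ALONG A CHAIN.**  For a chain of dominant terms at strictly increasing integer slopes and indices `i < j < k`:
if `T` is invariant under `σᵢ⁻¹σⱼ` and the terms `i`, `k` agree on `T`, then term `j` agrees with them on `T` — each sub-assignment of the
columns `T` onto a fixed row set is dominant during one era. [folklore] -/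
theorem chain_eqOn_of_between (d : Fin K → ℕ) (v ε : Fin m → Fin m → Fin K → ℤ) {n : ℕ} {θ : Fin (n + 1) → ℤ}
    (hθ : StrictMono θ) {p : Fin (n + 1) → Equiv.Perm (Fin m) × (Fin m → Fin K)} (hdom : ∀ t, IsDominant d v ε (θ t) (p t))
    {i j k : Fin (n + 1)} (hij : i < j) (hjk : j < k) (T : Finset (Fin m))
    (hT : ∀ b, ((p i).1⁻¹ * (p j).1) b ∈ T ↔ b ∈ T) (hik : ∀ b ∈ T, (p i).1 b = (p k).1 b ∧ (p i).2 b = (p k).2 b) :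
    ∀ b ∈ T, (p j).1 b = (p i).1 b ∧ (p j).2 b = (p i).2 b :=
  eqOn_of_between d v ε (hθ hij) (hθ hjk) (hdom i) (hdom j) (hdom k) T hT hik

/-- **NO RETURN along a chain.** [folklore] -/
theorem chain_not_restored (d : Fin K → ℕ) (v ε : Fin m → Fin m → Fin K → ℤ) {n : ℕ} {θ : Fin (n + 1) → ℤ}
    (hθ : StrictMono θ) {p : Fin (n + 1) → Equiv.Perm (Fin m) × (Fin m → Fin K)} (hdom : ∀ t, IsDominant d v ε (θ t) (p t))
    {i j k : Fin (n + 1)} (hij : i < j) (hjk : j < k) (T : Finset (Fin m))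
    (hT : ∀ b, ((p i).1⁻¹ * (p j).1) b ∈ T ↔ b ∈ T) (hne : ∃ b ∈ T, (p i).1 b ≠ (p j).1 b ∨ (p i).2 b ≠ (p j).2 b) :
    ¬ ∀ b ∈ T, (p i).1 b = (p k).1 b ∧ (p i).2 b = (p k).2 b :=
  not_restored d v ε (hθ hij) (hθ hjk) (hdom i) (hdom j) (hdom k) T hT hne

/-- **The whole-column-set case `T = univ`**: a dominant chain never revisits a term (each term is dominant during one era); the
familiar injectivity of chains, here as the `T = univ` instance of expiration. [folklore] -/
theorem chain_ne_of_lt (d : Fin K → ℕ) (v ε : Fin m → Fin m → Fin K → ℤ) {n : ℕ} {θ : Fin (n + 1) → ℤ}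
    (hθ : StrictMono θ) {p : Fin (n + 1) → Equiv.Perm (Fin m) × (Fin m → Fin K)} (hdom : ∀ t, IsDominant d v ε (θ t) (p t))
    {i j k : Fin (n + 1)} (hij : i < j) (hjk : j < k) (hne : p i ≠ p j) : p i ≠ p k := by
  intro hik
  have hT : ∀ b, ((p i).1⁻¹ * (p j).1) b ∈ (Finset.univ : Finset (Fin m)) ↔ b ∈ (Finset.univ : Finset (Fin m)) :=
    fun b => by simp
  have hne' : ∃ b ∈ (Finset.univ : Finset (Fin m)), (p i).1 b ≠ (p j).1 b ∨ (p i).2 b ≠ (p j).2 b := by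
    by_contra h
    push Not at h
    apply hne
    refine Prod.ext (Equiv.ext fun b => (h b (Finset.mem_univ b)).1) (funext fun b => (h b (Finset.mem_univ b)).2)
  exact chain_not_restored d v ε hθ hdom hij hjk Finset.univ hT hne'
    (fun b _ => ⟨by rw [hik], by rw [hik]⟩)

end Summit.ValiantsHypothesis.ValiantsHypothesis.Theorems.KPlusLogSqLaw.Expiration
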